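import Summits.QuantumFields.YangMills.Theorems.BalabanUVNodesN15CurvedGluingSmoothCutDressedGluedAdjointRightInverseDefectFlatCut
import Summits.QuantumFields.YangMills.Theorems.BalabanUVNodesN15TwoSpacingGluingCurvedCoverRightEntriesDefect
import Summits.QuantumFields.YangMills.Theorems.BalabanUVNodesN15TwoSpacingGluingCurvedCoverShiftFits
import Summits.QuantumFields.YangMills.Theorems.BalabanUVNodesN15TwoSpacingGluingCurvedKnitAdjoint
import Summits.QuantumFields.YangMills.Theorems.BalabanUVNodesN15TwoSpacingGluingCurvedKnitGradientDefect
import HarnessLib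

/-!
# ENTRY 2 OF THE LIVE GLUED PROPAGATOR AT THE COVER, ONE GRID, AT THE FINE SPACING `L^{−(r+k)}`, GLOBAL GAUGE: `cvGlued′ … 1 U′ (N′_L ⊗ 1) 0 ∘ ∇̂′⁻_ν` DECAYS ON THE COARSE UNIT BLOCKS —
# n15-c∕173 ★★★ instantiated at the FINE torus of the cover (blocks `B ∘ π̂`, King's pairing), every cover row discharged by name exactly as n15-c∕177 does for its fine half
# (dag-n15-c g20, n15-c∕175f — the fine twin of n15-c∕175 `one_bgrad_cvGlued_spec`; N15 = NE2, s1 road (c) «print-faithful non-abelian G(U)»)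

Cell `pub-ymgap`, seat `pub-ymgap-dag-n15-c` (R134 (a); HUMAN RULING D-0062), generation 20.  `bears_on: R4∕N15 · K3⁸ SpineGivenEndpointR13SepCoPHV (stmt-QuantumFields-27366)`.
Filed `--kind proof --supports stmt-QuantumFields-27366 --as helper` — COUNT-NEUTRAL.  Theorems only; 0 `def`, 0 `sorry`.  Imports BY NAME (as n15-c∕177): n15-c∕174b, 177a, 177b, 175 (through it
173 ★★★ `hasMaj_rightInverse_bgrad_smoothCutDressed_of_flat`, 172, 171, FILE 130, FILE 124 `uN_cvGlued'_spec`), FILE 138 (cover defect rows 121∕122∕122b, `liftBlk_blkCover_comp_kingPrV`).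
Nothing in the tree is modified; nothing restated.

WHY.  The node's slot 2 `𝒢∘∇^{U*}_ν` is the adjoint entry `𝒢∘∇̂⁻_ν` followed by FILE 159's transport `(𝒢∘∇̂⁻)∘M_{R∘e} − 𝒢∘M_{∇R} + 𝒢∘M_B`; the two-grid η-defect of a RIGHT composition
`𝔇(T′∘M′, T∘M) = T′∘𝔇(M′,M) + 𝔇(T′,T)∘M` needs the ONE-GRID row of the FINE operator `T′ = cvGlued′∘∇̂′⁻_ν` on the coarse unit blocks — this file (n15-c∕175 is its coarse twin).

WHAT.  ★★★ `one_bgrad_cvGlued'_spec`: for odd `L ≥ 7`, `a > 0`, `ι`: `∃ δ w₀ R₀ B > 0`, for every cover torus `2L·L^m` (`k ≥ 1`, `L^m ≥ w₀`), refinement `r`, direction `ν`, trace-form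
`e`, EVERY fine bond field `U′` whose species letters (`C(U′)`, `A(U′)`, `∇A(U′)` in the global gauge at spacing `η′ = (L^rL^k)^{−1}`) are `≤ r_S ≤ R₀`:
`cvGlued′ … 1 U′ (N′_L ⊗ 1) 0 ∘ ∇̂′⁻_ν ≤ B·e^{−(δ∕16)|y−y′|}` in the block norm of the coarse unit blocks read through `π̂` (both sides).

HONEST FRAMING ∕ LIMITS.  Bookkeeping over LANDED theorems on dag-n15-a's MODEL carriers; `U′` and its letters are DISPLAYED hypotheses; nothing of [B5]∕[B6]∕[B9] asserted (Thm 3.1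
(3.42) = SHAPE).  NE2 for non-abelian `G(U)` NOT proved (C-N15-1); N15 of record untouched (№253) — road (c)'s bookkeeping, NO count; K3⁸ skeleton untouched; one finite 𝕋⁴ at fixed ε —
NOT infinite volume, NOT OS, NOT a mass gap, NOT Clay.  Restate-immune (no Theses import).
-/
noncomputable section

open scoped BigOperators Matrix Matrix.Norms.Frobenius

namespace Summit.QuantumFields.YangMills.BalabanUVNodes.N15.Gluing

open Real
open Literature.MathematicalPhysics.QuantumFieldTheory.Balaban1983to89
open Literature.MathematicalPhysics.QuantumFieldTheory.Balaban1983to89.B5Prop11Plancherel (Tor fine unitVec)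
open Literature.MathematicalPhysics.QuantumFieldTheory.Balaban1983to89.B11SectG (BlockNorm HasMaj RowSum hasMaj_zero)
open Literature.MathematicalPhysics.QuantumFieldTheory.Balaban1983to89.B6RandomWalk (Triangle254)
open Literature.MathematicalPhysics.QuantumFieldTheory.Balaban1983to89.T4EtaRateDefect (idef idef_zero)
open Literature.MathematicalPhysics.QuantumFieldTheory.Balaban1983to89.T4EtaRateCoeffDefect (pull diagK diagK_nonneg diagK_same hasMaj_mulOp hasMaj_pull)
open Literature.MathematicalPhysics.QuantumFieldTheory.Balaban1983to89.B6Prop26Gluing (mulOp mulOp_apply ind ind_nonneg ind_le_one)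
open Literature.MathematicalPhysics.QuantumFieldTheory.Balaban1983to89.B6UnitTorusCarrier (unitTorusGeo triangle254_unitTorusGeo rowSum_unitTorusGeo unitTorusGeo_dist_nonneg
  unitTorusGeo_dist_symm unitTorusGeo_dist_self)
open Literature.MathematicalPhysics.QuantumFieldTheory.Balaban1983to89.B5SiteBridgeP12 (MP)
open Literature.MathematicalPhysics.QuantumFieldTheory.King1986.Torus (blockOf tdistT tdistT_nonneg tdistT_symm)
open Literature.Barriers.QuantumFields (traceForm)
open Summit.QuantumFields.YangMills.BalabanUVNodes.N15.BackgroundLayer (fgrad fgradAdj bgrad fgrad_apply fgradAdj_apply bgrad_apply stack projO projO_none_comp_stack bgPropV blkPair liftPair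
  covLapM tCoefA tCoefC unstackM fgradMat hasMaj_unstackM hasMaj_idef_unstackM tensorId_comp_tensorId TwoSidedLetters)
open Summit.QuantumFields.YangMills.BalabanUVNodes.N15.VectorPiece (bshiftEquiv bshiftEquiv_apply kingPrV tensorId hasMaj_tensorId tdistT_blockOf_sub_unitVec_le)
open Summit.QuantumFields.YangMills.BalabanUVNodes.N15.MatrixSpecies (mmulOp coordMat liftBlk liftMap liftEquiv liftEquiv_apply liftEquiv_symm_apply)
open Summit.QuantumFields.YangMills.BalabanUVNodes.N15.TwoGrid (paramsOf symbOp sD sTinv symOp landauRe qvRe qvAdjRe gOp neumannCubeG chiCube cubeBlocks ineq110_114_pair hasMaj_gOp_of_ineq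
  hasMaj_grad_of_ineq hasMaj_gGrad_of_ineq hasMaj_chiCube_symOp_gGrad_of hasMaj_chiCube_symOp_gDivAdj_of_ineq hasMaj_landauRe chiCube_of_not_mem abs_chiCube_le_one tensorId_mulOp
  mulOp_fst_comp_tensorId tensorId_comp_mulOp_fst chiCube_kingPrV hasMaj_idef_rightGrad hasMaj_idef_rightBgrad hasMaj_idef_chiCube_neumannCubeG
  hasMaj_idef_chiCube_grad_neumannCubeG hasMaj_idef_chiCube_divAdjOut_neumannCubeG)
open Summit.QuantumFields.YangMills.BalabanUVNodes.N15.CurvedSpecies (gaugePair uN_localOp_species_form)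

variable {d : ℕ}

section Knit

variable {L : ℕ} [NeZero L]

set_option maxHeartbeats 1600000 in
set_option maxRecDepth 4096 in
/-- ★★★ **ENTRY 2 `cvGlued′∘∇̂′⁻_ν` OF THE LIVE GLUED PROPAGATOR AT THE FINE SPACING OF THE COVER, ONE GRID, GLOBAL GAUGE, ON THE COARSE UNIT BLOCKS** — n15-c∕173 ★★★ instantiated
with the fine cut flat cubes of the cover; displayed: the bond field `U′` and the GLOBAL row letters `r_S ≤ R₀` of its species. [cite: Balaban1985BackgroundPropagators, Thm 3.1
p.397 ((3.42), entry `G∇*`: shape), (3.34)–(3.35) p.396, (3.62)–(3.65) pp.402–403; Balaban1984PropagatorsII, (2.36)–(2.37) p.229, (2.91)–(2.93) p.239, (2.133)–(2.136) p.247; King1986, p.664 (pairing)] -/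
theorem one_bgrad_cvGlued'_spec (hL : Odd L ∧ 1 < L) (hL7 : 7 ≤ L) {a : ℝ} (ha : 0 < a) (ι : Type) [Fintype ι] [DecidableEq ι] :
    ∃ δ w₀ R₀ B : ℝ, 0 < δ ∧ 0 < R₀ ∧ 0 < B ∧
      ∀ (mv kk r : ℕ) (ν : Fin (d + 1)), 1 ≤ kk → w₀ ≤ ((L ^ mv : ℕ) : ℝ) →
      ∀ {mm : Type} [Fintype mm] [DecidableEq mm] (e : Matrix mm mm ℂ ≃L[ℝ] (ι → ℝ)), (∀ A B : Matrix mm mm ℂ, traceForm A B = e A ⬝ᵥ e B) →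
      ∀ (U' : Fin (d + 1) → CvX' d L mv kk r hL → Matrix mm mm ℂ) (rS : ℝ), 0 ≤ rS → rS ≤ R₀ →
        (∀ x i, ∑ j, |tCoefC ((((L ^ r * L ^ kk : ℕ) : ℝ))⁻¹) (gaugePair (bshiftEquiv (cvM d L mv kk hL) (L ^ r * L ^ kk)) fun μ x => coordMat e (ContinuousLinearMap.mulLeftRight ℝ (Matrix mm mm ℂ) ((1 : Matrix mm mm ℂ) * U' μ x * (1 : Matrix mm mm ℂ)ᴴ) ((1 : Matrix mm mm ℂ) * U' μ x * (1 : Matrix mm mm ℂ)ᴴ)ᴴ)) x i j| ≤ rS) →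
        (∀ j' x i, ∑ j, |tCoefA ((((L ^ r * L ^ kk : ℕ) : ℝ))⁻¹) (gaugePair (bshiftEquiv (cvM d L mv kk hL) (L ^ r * L ^ kk)) fun μ x => coordMat e (ContinuousLinearMap.mulLeftRight ℝ (Matrix mm mm ℂ) ((1 : Matrix mm mm ℂ) * U' μ x * (1 : Matrix mm mm ℂ)ᴴ) ((1 : Matrix mm mm ℂ) * U' μ x * (1 : Matrix mm mm ℂ)ᴴ)ᴴ)) j' x i j| ≤ rS) →
        (∀ μ' x i, ∑ j, |fgradMat ((((L ^ r * L ^ kk : ℕ) : ℝ))⁻¹)⁻¹ ((bshiftEquiv (cvM d L mv kk hL) (L ^ r * L ^ kk)) μ') (tCoefA ((((L ^ r * L ^ kk : ℕ) : ℝ))⁻¹) (gaugePair (bshiftEquiv (cvM d L mv kk hL) (L ^ r * L ^ kk)) fun μ x => coordMat e (ContinuousLinearMap.mulLeftRight ℝ (Matrix mm mm ℂ) ((1 : Matrix mm mm ℂ) * U' μ x * (1 : Matrix mm mm ℂ)ᴴ) ((1 : Matrix mm mm ℂ) * U' μ x * (1 : Matrix mm mm ℂ)ᴴ)ᴴ))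 (Sum.inl μ')) x i j| ≤ rS) →
        (∀ μ' x i, ∑ j, |fgradMat ((((L ^ r * L ^ kk : ℕ) : ℝ))⁻¹)⁻¹ ((bshiftEquiv (cvM d L mv kk hL) (L ^ r * L ^ kk)) μ') (tCoefA ((((L ^ r * L ^ kk : ℕ) : ℝ))⁻¹) (gaugePair (bshiftEquiv (cvM d L mv kk hL) (L ^ r * L ^ kk)) fun μ x => coordMat e (ContinuousLinearMap.mulLeftRight ℝ (Matrix mm mm ℂ) ((1 : Matrix mm mm ℂ) * U' μ x * (1 : Matrix mm mm ℂ)ᴴ) ((1 : Matrix mm mm ℂ) * U' μ x * (1 : Matrix mm mm ℂ)ᴴ)ᴴ)) (Sum.inr μ')) x i j| ≤ rS) →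
        HasMaj (BlockNorm.ofBlocks (unitTorusGeo L kk (cvM d L mv kk hL)) (liftBlk (cvBlk d L mv kk hL ∘ (kingPrV L kk r (cvM d L mv kk hL))) ι)) (BlockNorm.ofBlocks (unitTorusGeo L kk (cvM d L mv kk hL)) (liftBlk (cvBlk d L mv kk hL ∘ (kingPrV L kk r (cvM d L mv kk hL))) ι))
          ((cvGlued' d L mv kk r hL a ((((L ^ r * L ^ kk : ℕ) : ℝ))⁻¹) ι e (fun _ _ => (1 : Matrix mm mm ℂ)) U' (cvNL' d L mv kk r hL a ι) (fun _ => 0)) ∘ₗ bgrad ((((L ^ r * L ^ kk : ℕ) : ℝ))⁻¹)⁻¹ (liftEquiv ((bshiftEquiv (cvM d L mv kk hL) (L ^ r * L ^ kk)) ν) ι))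
          (fun y y' => B * Real.exp (-(δ / 16 * (unitTorusGeo L kk (cvM d L mv kk hL)).dist y y'))) := by
  have hLodd : Odd L := hL.1; have hL3 : 3 ≤ L := by omega
  have hL2 : 2 ≤ L := by omega
  have hLpos : 0 < L := by omega
  obtain ⟨δ₀, C, Cα, Cε, Cαε, hδ₀, hC, H⟩ := ineq110_114_pair (d := d) hL ha; obtain ⟨δ₁, C₁, hδ₁, hC₁, HL⟩ := hasMaj_landauRe (d := d) (L := L); obtain ⟨δ'', w₀'', R₀'', θ₀'', B'', hδ'', hR₀'', hθ₀'', hB'', H124⟩ := uN_cvGlued'_spec (d := d) hL hL7 ha ι; obtain ⟨δm, hδm⟩ : ∃ δm : ℝ, δm = min δ₀ δ₁ := ⟨_, rfl⟩; have hδm0 : 0 < δm := by rw [hδm]; exact lt_min hδ₀ hδ₁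
  have hδmδ₀ : δm ≤ δ₀ := by rw [hδm]; exact min_le_left _ _
  have hδmδ₁ : δm ≤ δ₁ := by rw [hδm]; exact min_le_right _ _
  let cr : ℝ := B4Sect5Proof.latticeConst (d + 1) (δm / 32); have hcr_def : cr = B4Sect5Proof.latticeConst (d + 1) (δm / 32) := rfl; have hcr0 : 0 ≤ cr := B4Sect5Proof.latticeConst_nonneg (d + 1) (show (0 : ℝ) ≤ δm / 32 from div_nonneg hδm0.le (by norm_num)); let β : ℝ := 2 ^ (d + 1) * (C * Real.exp δ₀); have hβdef : β = 2 ^ (d + 1) * (C * Real.exp δ₀) := rfl; let β₁ : ℝ := 2 ^ (d + 1) * (C * Real.exp δ₀ * Real.exp δ₀); have hβ₁def : β₁ = 2 ^ (d + 1) * (C * Real.exp δ₀ * Real.exp δ₀) := rfl; let βQ : ℝ := 2 ^ (d + 1) * (2 * (C * Real.exp δ₀) * Real.exp δ₀); have hβQdef : βQ = 2 ^ (d + 1) * (2 * (C * Real.exp δ₀) * Real.exp δ₀) := rfl; let cN₀ : ℝ := |a| * (Real.exp δm * Real.exp δm) + C₁; have hcN₀def : cN₀ = |a| * (Real.exp δm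 * Real.exp δm) + C₁ := rfl; let Nov : ℝ := (((2 * L) ^ (d + 1) : ℕ) : ℝ); have hNovdef : Nov = (((2 * L) ^ (d + 1) : ℕ) : ℝ) := rfl; let cJ : ℝ := (Fintype.card (Fin (d + 1)) : ℝ); have hcJdef : cJ = (Fintype.card (Fin (d + 1)) : ℝ) := rfl; let cJJ : ℝ := (1 : ℝ) + Fintype.card (Fin (d + 1) ⊕ Fin (d + 1)); have hcJJdef : cJJ = (1 : ℝ) + Fintype.card (Fin (d + 1) ⊕ Fin (d + 1)) := rfl; let πD : ℝ := π * (d + 1); have hπDdef : πD = π * (d + 1) := rfl; let E' : ℝ := (Real.exp 1 * (δm / 2))⁻¹; have hE'def : E' = (Real.exp 1 * (δm / 2))⁻¹ := rfl; let cNn : ℝ := (πD * E' + 2 * πD) * cN₀; have hcNndef : cNn = (πD * E' + 2 * πD) * cN₀ := rfl; let κF : ℝ := 2 ^ (d + 1) * (1 * C * (cN₀ * (4 / δm))) * cr * Real.exp (δm / 2)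
  have hκFdef : κF = 2 ^ (d + 1) * (1 * C * (cN₀ * (4 / δm))) * cr * Real.exp (δm / 2) := rfl; let θ₁ : ℝ := β + cJ * (2 * (βQ + β)); have hθ₁def : θ₁ = β + cJ * (2 * (βQ + β)) := rfl; let R₀ : ℝ := min (R₀'' / cJJ) (1 / (cJJ * (2 * ((β + (β₁ + π * β)) * cr * cr)) + 2 * (θ₁ * cr) + 1)); have hR₀def : R₀ = min (R₀'' / cJJ) (1 / (cJJ * (2 * ((β + (β₁ + π * β)) * cr * cr)) + 2 * (θ₁ * cr) + 1)) := rfl; let Rsp : ℝ := R₀ * cJJ; have hRspdef : Rsp = R₀ * cJJ := rfl; let θA : ℝ := θ₁ * R₀; have hθAdef : θA = θ₁ * R₀ := rfl; let Ktot : ℝ := ((((((cJ * ((3 * (((β + (β₁ + (π * β))) * (1 - (((β + (β₁ + (π * β))) * (Rsp * cr)) * cr))⁻¹) * (32 * π ^ 2))) + (2 * ((((1 - (θA * cr))⁻¹ * βQ) * cr) * π)))) + 0) + ((((β + (β₁ + (π * β))) * (1 - (((β + (β₁ + (π * β))) * (Rsp * cr)) * cr))⁻¹) * cNn) * cr)) +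 ((cJ * ((2 * R₀) * ((π * ((β + (β₁ + (π * β))) * (1 - (((β + (β₁ + (π * β))) * (Rsp * cr)) * cr))⁻¹)) + (π * (((1 - (θA * cr))⁻¹ * βQ) * cr))))) + ((((β + (β₁ + (π * β))) * (1 - (((β + (β₁ + (π * β))) * (Rsp * cr)) * cr))⁻¹) * (((πD * ((Real.exp 1) * (δm / 2))⁻¹) + (2 * πD)) * 0)) * cr))) + 0) + (((1 - (θA * cr))⁻¹ * κF) * cr))
  have hKtotdef : Ktot = ((((((cJ * ((3 * (((β + (β₁ + (π * β))) * (1 - (((β + (β₁ + (π * β))) * (Rsp * cr)) * cr))⁻¹) * (32 * π ^ 2))) + (2 * ((((1 - (θA * cr))⁻¹ * βQ) * cr) * π)))) + 0) + ((((β + (β₁ + (π * β))) * (1 - (((β + (β₁ + (π * β))) * (Rsp * cr)) * cr))⁻¹) * cNn) * cr)) + ((cJ * ((2 * R₀) * ((π * ((β + (β₁ + (π * β))) * (1 - (((β + (β₁ + (π * β))) * (Rsp * cr)) * cr))⁻¹)) + (π * (((1 - (θA * cr))⁻¹ * βQ) * cr))))) + ((((β + (β₁ + (π * β))) * (1 -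 (((β + (β₁ + (π * β))) * (Rsp * cr)) * cr))⁻¹) * (((πD * ((Real.exp 1) * (δm / 2))⁻¹) + (2 * πD)) * 0)) * cr))) + 0) + (((1 - (θA * cr))⁻¹ * κF) * cr)) := rfl; let w₀ : ℝ := max w₀'' (2 * (Nov * Ktot * cr) + 3); have hw₀def : w₀ = max w₀'' (2 * (Nov * Ktot * cr) + 3) := rfl; let Bout : ℝ := 2 * (Nov * (((1 - θA * cr)⁻¹ * βQ * cr) * 1 + ((β + (β₁ + π * β)) * (1 - (β + (β₁ + π * β)) * (Rsp * cr) * cr)⁻¹) * π)) * cr + 1; have hBoutdef : Bout = 2 * (Nov * (((1 - θA * cr)⁻¹ * βQ * cr) * 1 + ((β + (β₁ + π * β)) * (1 - (β + (β₁ + π * β)) * (Rsp * cr) * cr)⁻¹) * π)) * cr + 1 := rfl; have hβ0 : 0 ≤ β := by clear H HL H124; positivity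
  have hβ₁0 : 0 ≤ β₁ := by clear H HL H124; positivity
  have hβQ0 : 0 ≤ βQ := by clear H HL H124; positivity
  have hcN₀0 : 0 ≤ cN₀ := by clear H HL H124; positivity
  have hNov0 : 0 ≤ Nov := by clear H HL H124; positivity
  have hcJ0 : 0 ≤ cJ := by clear H HL H124; positivity
  have hE'0 : 0 ≤ E' := by clear H HL H124; positivity
  have hcJJ1 : 1 ≤ cJJ := by
    rw [hcJJdef]; have : (0 : ℝ) ≤ Fintype.card (Fin (d + 1) ⊕ Fin (d + 1)) := Nat.cast_nonneg _; linarith only [this]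
  have hcJJ0 : 0 < cJJ := by linarith only [hcJJ1]
  have hθ₁0 : 0 ≤ θ₁ := by clear H HL H124; positivity
  have hden0 : 0 < cJJ * (2 * ((β + (β₁ + π * β)) * cr * cr)) + 2 * (θ₁ * cr) + 1 := by clear H HL H124; positivity
  have hR₀0 : 0 < R₀ := by rw [hR₀def]; exact lt_min (div_pos hR₀'' hcJJ0) (one_div_pos.mpr hden0)
  have hRsp0 : 0 ≤ Rsp := by clear H HL H124; positivity
  have hθA0 : 0 ≤ θA := by clear H HL H124; positivity
  have hR₀le : R₀ ≤ 1 / (cJJ * (2 * ((β + (β₁ + π * β)) * cr * cr)) + 2 * (θ₁ * cr) + 1) := by rw [hR₀def]; exact min_le_right _ _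
  have hR₀le'' : R₀ ≤ R₀'' / cJJ := by rw [hR₀def]; exact min_le_left _ _
  have hq₀ : (β + (β₁ + π * β)) * (Rsp * cr) * cr ≤ 1 / 2 := by
    have h1 : R₀ * (cJJ * (2 * ((β + (β₁ + π * β)) * cr * cr)) + 2 * (θ₁ * cr) + 1) ≤ 1 := by
      have := mul_le_mul_of_nonneg_right hR₀le hden0.le
      rwa [one_div, inv_mul_cancel₀ hden0.ne'] at this
    have h2 : 0 ≤ R₀ * (2 * (θ₁ * cr) + 1) := by clear H HL H124; positivity
    have e : (β + (β₁ + π * β)) * (Rsp * cr) * cr = (R₀ * (cJJ * (2 * ((β + (β₁ + π * β)) * cr * cr)))) / 2 := by rw [hRspdef]; ring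
    rw [e]; linarith only [h1, h2]
  have hqA₀ : θA * cr ≤ 1 / 2 := by
    have h1 : R₀ * (cJJ * (2 * ((β + (β₁ + π * β)) * cr * cr)) + 2 * (θ₁ * cr) + 1) ≤ 1 := by
      have := mul_le_mul_of_nonneg_right hR₀le hden0.le
      rwa [one_div, inv_mul_cancel₀ hden0.ne'] at this
    have h2 : 0 ≤ R₀ * (cJJ * (2 * ((β + (β₁ + π * β)) * cr * cr)) + 1) := by clear H HL H124; positivity
    have e : θA * cr = (R₀ * (2 * (θ₁ * cr))) / 2 := by rw [hθAdef]; ring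
    rw [e]; linarith only [h1, h2]
  have hq : (β + (β₁ + π * β)) * (Rsp * cr) * cr < 1 := hq₀.trans_lt (by norm_num); have hqA : θA * cr < 1 := hqA₀.trans_lt (by norm_num); have hIA0 : 0 ≤ (1 - θA * cr)⁻¹ := inv_nonneg.2 (by linarith only [hqA]); have hIA2 : (1 - θA * cr)⁻¹ ≤ 2 := by rw [inv_le_comm₀ (by linarith only [hqA]) (by norm_num)]; linarith only [hqA₀]
  have hBB0 : 0 ≤ ((β + (β₁ + π * β)) * (1 - (β + (β₁ + π * β)) * (Rsp * cr) * cr)⁻¹) := mul_nonneg (by clear H HL H124; positivity) (inv_nonneg.2 (by linarith only [hq])); have hBBi0 : 0 ≤ (1 - (β + (β₁ + π * β)) * (Rsp * cr) * cr)⁻¹ := inv_nonneg.2 (by linarith only [hq]); have hBX0 : 0 ≤ ((1 - θA * cr)⁻¹ * βQ * cr) := by clear H HL H124; positivity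
  have hK0 : 0 ≤ Ktot := by
    clear H HL H124
    rw [hKtotdef]
    have h1 := hBBi0; have h3 := hIA0
    generalize (1 - (β + (β₁ + π * β)) * (Rsp * cr) * cr)⁻¹ = BBv at h1 ⊢
    generalize (1 - θA * cr)⁻¹ = IAv at h3 ⊢
    positivity
  have hcNn0 : 0 ≤ cNn := by clear H HL H124; positivity
  have hπD0 : 0 ≤ πD := by clear H HL H124; positivity
  have hκF0 : 0 ≤ κF := by clear H HL H124; positivity
  have hBout0 : 0 < Bout := by clear H HL H124; positivity
  refine ⟨δm, w₀, R₀, Bout, hδm0, hR₀0, hBout0, fun mv kk r ν hk hw₀ => ?_⟩; intro mm _ _ e he U' rS hrS hrSle hCg' hAg' hga' hgb'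
  -- the data of the cover at `(m, k, r)`
  let W : ℝ := ((L ^ mv : ℕ) : ℝ); have hWdef : W = ((L ^ mv : ℕ) : ℝ) := rfl; have hn : 1 ≤ L ^ kk := Nat.one_le_pow _ _ (by omega); have hn' : 1 ≤ L ^ r * L ^ kk := Nat.one_le_iff_ne_zero.mpr (Nat.mul_ne_zero (pow_ne_zero r (NeZero.ne L)) (pow_ne_zero kk (NeZero.ne L))); have hw₀'' : w₀'' ≤ ((L ^ mv : ℕ) : ℝ) := (le_max_left _ _).trans hw₀; have hWK : 2 * (Nov * Ktot * cr) + 3 ≤ W := (le_max_right _ _).trans hw₀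
  have hW3R : (3 : ℝ) ≤ W := by
    have : 0 ≤ 2 * (Nov * Ktot * cr) := mul_nonneg zero_le_two (mul_nonneg (mul_nonneg hNov0 hK0) hcr0); linarith only [hWK, this]
  have hW3 : 3 ≤ L ^ mv := by have h : (3 : ℝ) ≤ ((L ^ mv : ℕ) : ℝ) := hW3R; exact_mod_cast h
  have hW2 : 2 ≤ L ^ mv := by omega
  have hw : 0 < L ^ mv := by omega
  have hW1 : (1 : ℝ) ≤ W := by linarith only [hW3R]
  have hWpos : (0 : ℝ) < W := by linarith only [hW3R]
  have hn'R0 : (0 : ℝ) < ((L ^ r * L ^ kk : ℕ) : ℝ) := Nat.cast_pos.mpr (Nat.mul_pos (pow_pos hLpos r) (pow_pos hLpos kk)); have hM : ∀ ν, cvM d L mv kk hL ν = 2 * L * L ^ mv := MP_succ_eq L mv kk hL; have hM' : ∀ ν, cvM d L mv kk hL ν = 2 * (L * L ^ mv) := fun ν => by rw [hM ν, mul_assoc]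
  have hlo : (2 : ℝ) * ((L ^ mv : ℕ) : ℝ) ≤ ((2 * L ^ mv : ℕ) : ℝ) := by push_cast; exact le_rfl
  have hhi : ((2 * L ^ mv : ℕ) : ℝ) + ((L ^ mv : ℕ) : ℝ) + (2 + 1) * ((L ^ mv : ℕ) : ℝ) + 1 ≤ ((6 * L ^ mv + 1 : ℕ) : ℝ) := by push_cast; linarith only []
  have hS6 : 6 * L ^ mv + 1 ≤ 2 * L * L ^ mv := by
    have h7 : 7 * L ^ mv ≤ L * L ^ mv := Nat.mul_le_mul_right _ hL7
    have e : 2 * L * L ^ mv = 2 * (L * L ^ mv) := by ring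
    rw [e]; omega
  have hm₁ : 2 * L ^ mv ≤ coverMargin L mv := two_mul_le_coverMargin hL7 mv; have hfitI : coverMargin L mv - 2 * L ^ mv + (6 * L ^ mv + 1) ≤ L * L ^ mv := coverMargin_inner_fit hL7 hW2; obtain ⟨hm₂, hfit₂⟩ := coverMargin_cut_margin hL7 hW3; have hfit0 := coverMargin_fit hL3 mv; have hfit : coverMargin L mv + 2 * L ^ mv + 1 ≤ L * L ^ mv := by omega
  have hhi4 : coverMargin L mv + 4 * L ^ mv + 1 ≤ L * L ^ mv := by omega
  have hS0 : L * L ^ mv ≤ 2 * L * L ^ mv := by rw [mul_assoc]; omega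
  let η' : ℝ := ((((L ^ r * L ^ kk : ℕ) : ℝ))⁻¹); have hη' : η' = ((((L ^ r * L ^ kk : ℕ) : ℝ))⁻¹) := rfl; have hη'inv : η'⁻¹ = ((L ^ r * L ^ kk : ℕ) : ℝ) := by rw [hη', inv_inv]
  have hη'1 : 1 ≤ η'⁻¹ := by rw [hη'inv]; exact_mod_cast hn'
  have hWinv0 : 0 ≤ W⁻¹ := inv_nonneg.2 hWpos.le; have hWinv1 : W⁻¹ ≤ 1 := inv_le_one_of_one_le₀ hW1; have hX1 : Real.exp (-((δm - 3 * δm / 4) * (((coverMargin L mv : ℕ) : ℝ) + 1))) ≤ 1 := Real.exp_le_one_iff.mpr (neg_nonpos.mpr (mul_nonneg (by linarith only [hδm0]) (by positivity))); have hF0 : 0 ≤ 2 ^ (d + 1) * ((1 : ℝ) * C * ((|a| * (Real.exp δm * Real.exp δm) + C₁) * Real.exp (-((δm - 3 * δm / 4) * (((coverMargin L mv : ℕ) : ℝ) + 1)))) * cr * Real.exp (δm / 2)) := mul_nonneg (pow_nonneg zero_le_two _) (mul_nonneg (mul_nonneg (mul_nonneg (mul_nonneg zero_le_one hC.le) (mul_nonneg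 hcN₀0 (Real.exp_nonneg _))) hcr0) (Real.exp_nonneg _))
  -- the torus letters at the fine spacing `L^r·L^k`
  have Hk' := (H (mv + 1) kk r hk).2; have hG' := hasMaj_gOp_of_ineq (L := L) (k := kk) (cvM d L mv kk hL) (L ^ r * L ^ kk) a hn' Hk' hC.le; have hD' := fun ν => hasMaj_grad_of_ineq (L := L) (k := kk) (cvM d L mv kk hL) (L ^ r * L ^ kk) a hn' Hk' hC.le ν; have hNL' := HL kk (L ^ r * L ^ kk) (cvM d L mv kk hL); have hGg' := fun μ => hasMaj_gGrad_of_ineq (L := L) (k := kk) (M := (cvM d L mv kk hL)) (n := L ^ r * L ^ kk) (a := a) hn' Hk' hC.le hδ₀.le μ; have htri : Triangle254 (unitTorusGeo L kk (cvM d L mv kk hL)) := triangle254_unitTorusGeo L kk _; have hd : ∀ a b, 0 ≤ (unitTorusGeo L kk (cvM d L mv kk hL)).dist a b := unitTorusGeo_dist_nonneg L kk _; have hd0 : ∀ y, (unitTorusGeo L kk (cvM d L mv kk hL)).dist y y = 0 := unitTorusGeo_dist_self L kk _; have hsymm : ∀ y y', (unitTorusGeo L kk (cvM d L mv kk hL)).dist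 y y' = (unitTorusGeo L kk (cvM d L mv kk hL)).dist y' y := unitTorusGeo_dist_symm L kk _; have hrow : RowSum (unitTorusGeo L kk (cvM d L mv kk hL)) (δm / 32) cr := by rw [hcr_def]; exact rowSum_unitTorusGeo L kk _ (show (0 : ℝ) < δm / 32 from div_pos hδm0 (by norm_num))
  -- the windows of the cut box about the partition cell (radius 2), fine spacing
  have hwin2' := fun μ k => chiCube_cover_lift_eq_one_of_near_bbox (n := L ^ r * L ^ kk) 2 ι hM hw hlo hhi hS6 μ k; have hwin' := fun μ k => hcubeWindow_of_bumpWindow (2 * L) (fun ν (p : CvX' d L mv kk r hL × ι) => coverXi (cvM d L mv kk hL) (L ^ r * L ^ kk) (L ^ mv) ν p.1) 2 (fun μ => liftEquiv ((bshiftEquiv (cvM d L mv kk hL) (L ^ r * L ^ kk)) μ) ι) μ (by norm_num) (hwin2' μ k)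
  -- `Δ′∘cvGlued′ = 1` (FILE 124 at `w ≡ 1`, `P := N′_L ⊗ 1`, `N_V := 0`)
  have hrSle'' : rS * (1 + Fintype.card (Fin (d + 1) ⊕ Fin (d + 1))) + 0 ≤ R₀'' := by
    rw [add_zero]
    have h1 : rS * cJJ ≤ R₀ * cJJ := mul_le_mul_of_nonneg_right hrSle hcJJ0.le
    have h2 : R₀ * cJJ ≤ R₀'' := by have := mul_le_mul_of_nonneg_right hR₀le'' hcJJ0.le; rwa [div_mul_cancel₀ _ hcJJ0.ne'] at this
    exact h1.trans h2
  have hY' := (H124 mv kk r hk hw₀'' e he (fun _ _ => (1 : Matrix mm mm ℂ)) (fun _ _ => by rw [Matrix.conjTranspose_one, Matrix.mul_one]) U' (cvNL' d L mv kk r hL a ι) (fun _ => 0) rS 0 0 hrS le_rfl le_rfl hrSle'' hθ₀''.le (fun k => conj_one_eq_sub_zero e (cvNL' d L mv kk r hL a ι)) (fun k x _ i => hCg' x i) (fun k j' x _ i => hAg' j' x i) (fun k => hasMaj_sandwich_zero _ _ _ _ le_rfl _) (fun k => hasMaj_sandwich_zero _ _ _ _ le_rfl _)).2.2; clear H HL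 H124
  -- the global operator IS the common model (52's species form at `w ≡ 1`), fine grid
  have hcov₀' : ∀ k : Fin (d + 1) → ZMod (2 * L), (covLapM (bshiftEquiv (cvM d L mv kk hL) (L ^ r * L ^ kk)) ((((L ^ r * L ^ kk : ℕ) : ℝ))⁻¹) (gaugePair (bshiftEquiv (cvM d L mv kk hL) (L ^ r * L ^ kk)) (fun μ x => coordMat e (ContinuousLinearMap.mulLeftRight ℝ (Matrix mm mm ℂ) (U' μ x) (U' μ x)ᴴ))) + cvNL' d L mv kk r hL a ι) =
      lapOp η'⁻¹ (fun μ => liftEquiv ((bshiftEquiv (cvM d L mv kk hL) (L ^ r * L ^ kk)) μ) ι) 0 + cvNL' d L mv kk r hL a ι - (unstackM (tCoefC ((((L ^ r * L ^ kk : ℕ) : ℝ))⁻¹) (gaugePair (bshiftEquiv (cvM d L mv kk hL) (L ^ r * L ^ kk)) fun μ x => coordMat e (ContinuousLinearMap.mulLeftRight ℝ (Matrix mm mm ℂ) ((1 : Matrix mm mm ℂ) * U' μ x * (1 : Matrix mm mm ℂ)ᴴ) ((1 : Matrix mm mm ℂ) * U' μ x * (1 : Matrix mm mm ℂ)ᴴ)ᴴ)))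 (tCoefA ((((L ^ r * L ^ kk : ℕ) : ℝ))⁻¹) (gaugePair (bshiftEquiv (cvM d L mv kk hL) (L ^ r * L ^ kk)) fun μ x => coordMat e (ContinuousLinearMap.mulLeftRight ℝ (Matrix mm mm ℂ) ((1 : Matrix mm mm ℂ) * U' μ x * (1 : Matrix mm mm ℂ)ᴴ) ((1 : Matrix mm mm ℂ) * U' μ x * (1 : Matrix mm mm ℂ)ᴴ)ᴴ))) + (0 : (CvX' d L mv kk r hL × ι → ℝ) →ₗ[ℝ] (CvX' d L mv kk r hL × ι → ℝ)) ∘ₗ projO (none : Option (Fin (d + 1) ⊕ Fin (d + 1)))) ∘ₗ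
        stack LinearMap.id (fun j => Sum.elim (fun μ => fgrad η'⁻¹ (liftEquiv ((bshiftEquiv (cvM d L mv kk hL) (L ^ r * L ^ kk)) μ) ι)) (fun μ => bgrad η'⁻¹ (liftEquiv ((bshiftEquiv (cvM d L mv kk hL) (L ^ r * L ^ kk)) μ) ι)) j) := fun k => by
    have h := uN_localOp_species_form (κ := ι) e (bshiftEquiv (cvM d L mv kk hL) (L ^ r * L ^ kk)) (fun _ => (1 : Matrix mm mm ℂ)) U' η' he (fun _ => by rw [Matrix.conjTranspose_one, Matrix.mul_one]) (cvNL' d L mv kk r hL a ι)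
    rw [mmulOp_coordMat_conj_one, mmulOp_coordMat_conj_one_transpose, LinearMap.id_comp, LinearMap.comp_id, LinearMap.comp_id] at h
    rw [LinearMap.zero_comp, add_zero]
    exact h
  -- the global species row on the fine grid (dag-n15-w1 `hasMaj_unstackM`), `N_V := 0`
  have hV' : ∀ k : Fin (d + 1) → ZMod (2 * L), HasMaj (BlockNorm.ofBlocks (unitTorusGeo L kk (cvM d L mv kk hL)) (blkPair (liftBlk (cvBlk d L mv kk hL ∘ (kingPrV L kk r (cvM d L mv kk hL))) ι))) (BlockNorm.ofBlocks (unitTorusGeo L kk (cvM d L mv kk hL)) (liftBlk (cvBlk d L mv kk hL ∘ (kingPrV L kk r (cvM d L mv kk hL))) ι))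
      (unstackM (tCoefC ((((L ^ r * L ^ kk : ℕ) : ℝ))⁻¹) (gaugePair (bshiftEquiv (cvM d L mv kk hL) (L ^ r * L ^ kk)) fun μ x => coordMat e (ContinuousLinearMap.mulLeftRight ℝ (Matrix mm mm ℂ) ((1 : Matrix mm mm ℂ) * U' μ x * (1 : Matrix mm mm ℂ)ᴴ) ((1 : Matrix mm mm ℂ) * U' μ x * (1 : Matrix mm mm ℂ)ᴴ)ᴴ))) (tCoefA ((((L ^ r * L ^ kk : ℕ) : ℝ))⁻¹) (gaugePair (bshiftEquiv (cvM d L mv kk hL) (L ^ r * L ^ kk)) fun μ x => coordMat e (ContinuousLinearMap.mulLeftRight ℝ (Matrix mm mm ℂ) ((1 : Matrix mm mm ℂ) * U' μ x * (1 : Matrix mm mm ℂ)ᴴ) ((1 : Matrix mm mm ℂ) * U' μ x * (1 : Matrix mm mm ℂ)ᴴ)ᴴ))) + (0 : (CvX' d L mv kk r hL × ι → ℝ) →ₗ[ℝ] (CvX' d L mv kk r hL × ι → ℝ)) ∘ₗ projO (none : Option (Fin (d + 1) ⊕ Fin (d + 1)))) (fun y y' => Rsp * Real.exp (-(δm * (unitTorusGeo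 L kk (cvM d L mv kk hL)).dist y y'))) := fun k => by
    rw [LinearMap.zero_comp, add_zero]
    refine (hasMaj_unstackM (g := (unitTorusGeo L kk (cvM d L mv kk hL))) (blk := cvBlk d L mv kk hL ∘ (kingPrV L kk r (cvM d L mv kk hL))) hrS hCg' (fun j => hAg' j)).mono fun y y' => ?_
    by_cases hyy : y = y'
    · subst hyy
      rw [diagK_same, hd0, mul_zero, neg_zero, Real.exp_zero, mul_one, hRspdef, hcJJdef]
      exact mul_le_mul_of_nonneg_right hrSle (by positivity)
    · rw [show diagK (fun _ => rS * (1 + (Fintype.card (Fin (d + 1) ⊕ Fin (d + 1)) : ℝ))) y y' = 0 from if_neg hyy]; exact mul_nonneg hRsp0 (Real.exp_nonneg _)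
  have hββQ : 2 ^ (d + 1) * (C * Real.exp δ₀) ≤ βQ := by
    rw [hβQdef]
    have h1 : (1 : ℝ) ≤ Real.exp δ₀ := Real.one_le_exp hδ₀.le
    have h2 : C * Real.exp δ₀ * 1 ≤ C * Real.exp δ₀ * (2 * Real.exp δ₀) := mul_le_mul_of_nonneg_left (by linarith only [h1]) (mul_nonneg hC.le (Real.exp_nonneg _))
    have h3 : C * Real.exp δ₀ ≤ 2 * (C * Real.exp δ₀) * Real.exp δ₀ := by linarith only [h2]
    exact mul_le_mul_of_nonneg_left h3 (by positivity)
  have hc₂w : 32 * π ^ 2 / (((L ^ mv : ℕ) : ℝ)) ^ 2 ≤ 32 * π ^ 2 * W⁻¹ := by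
    rw [← hWdef, div_eq_mul_inv]
    refine mul_le_mul_of_nonneg_left ?_ (by positivity)
    exact inv_anti₀ hWpos (by rw [sq]; exact le_mul_of_one_le_right hWpos.le hW1)
  have hh2' : ∀ (k : Fin (d + 1) → ZMod (2 * L)) (μ : Fin (d + 1)) (p : CvX' d L mv kk r hL × ι),
      |fgradAdj η'⁻¹ (liftEquiv ((bshiftEquiv (cvM d L mv kk hL) (L ^ r * L ^ kk)) μ) ι) (fgrad η'⁻¹ (liftEquiv ((bshiftEquiv (cvM d L mv kk hL) (L ^ r * L ^ kk)) μ) ι) (fun p : CvX' d L mv kk r hL × ι => (knitH d L mv kk (L ^ r * L ^ kk) hL k) p.1)) p| ≤ 32 * π ^ 2 * W⁻¹ := by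
    rw [hη'inv]; exact fun k μ p => (abs_fgradAdj_fgrad_coverH_lift_le ι hM hw k μ p).trans hc₂w
  have hεF : 2 ^ (d + 1) * ((1 : ℝ) * C * ((|a| * (Real.exp δm * Real.exp δm) + C₁) * Real.exp (-((δm - 3 * δm / 4) * (((coverMargin L mv : ℕ) : ℝ) + 1)))) * cr * Real.exp (δm / 2)) ≤ κF * W⁻¹ := by
    have hm0 : W ≤ ((coverMargin L mv : ℕ) : ℝ) + 1 := by
      have h2 : (2 : ℝ) * W ≤ ((coverMargin L mv : ℕ) : ℝ) := by rw [hWdef]; exact_mod_cast hm₁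
      linarith only [h2]
    have hx : 0 < δm / 4 * (((coverMargin L mv : ℕ) : ℝ) + 1) := mul_pos (div_pos hδm0 (by norm_num)) (by positivity)
    have hexp : Real.exp (-((δm - 3 * δm / 4) * (((coverMargin L mv : ℕ) : ℝ) + 1))) ≤ (4 / δm) * W⁻¹ := by
      rw [show (δm - 3 * δm / 4) * (((coverMargin L mv : ℕ) : ℝ) + 1) = δm / 4 * (((coverMargin L mv : ℕ) : ℝ) + 1) by ring, Real.exp_neg]
      calc (Real.exp (δm / 4 * (((coverMargin L mv : ℕ) : ℝ) + 1)))⁻¹ ≤ (δm / 4 * (((coverMargin L mv : ℕ) : ℝ) + 1))⁻¹ :=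
            inv_anti₀ hx (by linarith [Real.add_one_le_exp (δm / 4 * (((coverMargin L mv : ℕ) : ℝ) + 1))])
        _ = (4 / δm) * ((((coverMargin L mv : ℕ) : ℝ) + 1))⁻¹ := by rw [mul_inv, inv_div]
        _ ≤ (4 / δm) * W⁻¹ := mul_le_mul_of_nonneg_left (inv_anti₀ hWpos hm0) (div_nonneg (by norm_num) hδm0.le)
    rw [hκFdef, hcN₀def]
    calc 2 ^ (d + 1) * ((1 : ℝ) * C * ((|a| * (Real.exp δm * Real.exp δm) + C₁) * Real.exp (-((δm - 3 * δm / 4) * (((coverMargin L mv : ℕ) : ℝ) + 1)))) * cr * Real.exp (δm / 2))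
        = (2 ^ (d + 1) * (1 * C * (|a| * (Real.exp δm * Real.exp δm) + C₁)) * cr * Real.exp (δm / 2)) * Real.exp (-((δm - 3 * δm / 4) * (((coverMargin L mv : ℕ) : ℝ) + 1))) := by ring
      _ ≤ (2 ^ (d + 1) * (1 * C * (|a| * (Real.exp δm * Real.exp δm) + C₁)) * cr * Real.exp (δm / 2)) * ((4 / δm) * W⁻¹) := mul_le_mul_of_nonneg_left hexp (mul_nonneg (mul_nonneg (mul_nonneg (pow_nonneg zero_le_two _) (mul_nonneg (mul_nonneg zero_le_one hC.le) hcN₀0)) hcr0) (Real.exp_nonneg _))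
      _ = 2 ^ (d + 1) * (1 * C * ((|a| * (Real.exp δm * Real.exp δm) + C₁) * (4 / δm))) * cr * Real.exp (δm / 2) * W⁻¹ := by ring
  -- the one smallness: `N_ov(Θ + ε_E)c_r = N_ov·K·c_r∕W < 1`
  have hΘ : ((((((cJ * ((3 * (((β + (β₁ + (π * β))) * (1 - (((β + (β₁ + (π * β))) * (Rsp * cr)) * cr))⁻¹) * (32 * π ^ 2 * W⁻¹))) + (2 * ((((1 - (θA * cr))⁻¹ * βQ) * cr) * (π * W⁻¹))))) + 0) + ((((β + (β₁ + (π * β))) * (1 - (((β + (β₁ + (π * β))) * (Rsp * cr)) * cr))⁻¹) * (cNn * W⁻¹)) * cr)) + ((cJ * ((2 * R₀) * (((π * W⁻¹) * ((β + (β₁ + (π * β))) * (1 - (((β + (β₁ + (π * β))) * (Rsp * cr)) * cr))⁻¹)) + ((π * W⁻¹) * (((1 - (θA * cr))⁻¹ * βQ) * cr))))) + ((((β + (β₁ + (π * β))) * (1 - (((β + (β₁ + (π * β))) * (Rsp * cr)) * cr))⁻¹) * ((((πD * W⁻¹) * ((Real.exp 1) * (δm / 2))⁻¹) + (2 * (πD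 * W⁻¹))) * 0)) * cr))) + 0) + (((1 - (θA * cr))⁻¹ * (κF * W⁻¹)) * cr)) = Ktot * W⁻¹ := by rw [hKtotdef]; ring
  have hqL : Nov * ((((((cJ * ((3 * (((β + (β₁ + (π * β))) * (1 - (((β + (β₁ + (π * β))) * (Rsp * cr)) * cr))⁻¹) * (32 * π ^ 2 * W⁻¹))) + (2 * ((((1 - (θA * cr))⁻¹ * βQ) * cr) * (π * W⁻¹))))) + 0) + ((((β + (β₁ + (π * β))) * (1 - (((β + (β₁ + (π * β))) * (Rsp * cr)) * cr))⁻¹) * (cNn * W⁻¹)) * cr)) + ((cJ * ((2 * R₀) * (((π * W⁻¹) * ((β + (β₁ + (π * β))) * (1 - (((β + (β₁ + (π * β))) * (Rsp * cr)) * cr))⁻¹)) + ((π * W⁻¹) * (((1 - (θA * cr))⁻¹ * βQ) * cr))))) + ((((β + (β₁ + (π * β))) * (1 - (((β + (β₁ + (π * β))) * (Rsp * cr)) * cr))⁻¹) * ((((πD * W⁻¹) * ((Real.exp 1) * (δm / 2))⁻¹) + (2 * (πD * W⁻¹))) * 0)) * cr))) + 0) + (((1 - (θA * cr))⁻¹ *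 (κF * W⁻¹)) * cr)) * cr < 1 := by
    rw [hΘ, show Nov * (Ktot * W⁻¹) * cr = (Nov * Ktot * cr) * W⁻¹ by ring]
    have h1 : (Nov * Ktot * cr) * W⁻¹ ≤ (W / 2) * W⁻¹ := mul_le_mul_of_nonneg_right (by linarith only [hWK]) hWinv0
    rw [show (W / 2) * W⁻¹ = 1 / 2 by rw [div_eq_mul_inv, mul_right_comm, mul_inv_cancel₀ hWpos.ne', one_mul, one_div]] at h1
    linarith only [h1]
  have key := hasMaj_rightInverse_bgrad_smoothCutDressed_of_flat (X := CvX' d L mv kk r hL) (ι := ι) (J := Fin (d + 1)) (K := Fin (d + 1) → ZMod (2 * L))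
    (g := (unitTorusGeo L kk (cvM d L mv kk hL))) (cvBlk d L mv kk hL ∘ (kingPrV L kk r (cvM d L mv kk hL))) (bshiftEquiv (cvM d L mv kk hL) (L ^ r * L ^ kk)) η'⁻¹ ν (σ := δm / 32) (cr := cr) (N := fun k => mulOp (fun p : CvX' d L mv kk r hL × ι => cvPsi' d L mv kk r hL k p.1) ∘ₗ cvCube' d L mv kk r hL a ι k) (Cc := fun _ => (tCoefC ((((L ^ r * L ^ kk : ℕ) : ℝ))⁻¹) (gaugePair (bshiftEquiv (cvM d L mv kk hL) (L ^ r * L ^ kk)) fun μ x => coordMat e (ContinuousLinearMap.mulLeftRight ℝ (Matrix mm mm ℂ) ((1 : Matrix mm mm ℂ) * U' μ x * (1 : Matrix mm mm ℂ)ᴴ) ((1 : Matrix mm mm ℂ) * U' μ x * (1 : Matrix mm mm ℂ)ᴴ)ᴴ)))) (Ac := fun _ => (tCoefA ((((L ^ r * L ^ kk : ℕ) : ℝ))⁻¹) (gaugePair (bshiftEquiv (cvM d L mv kk hL) (L ^ r * L ^ kk)) fun μ x => coordMat e (ContinuousLinearMap.mulLeftRight ℝ (Matrix mm mm ℂ)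 ((1 : Matrix mm mm ℂ) * U' μ x * (1 : Matrix mm mm ℂ)ᴴ) ((1 : Matrix mm mm ℂ) * U' μ x * (1 : Matrix mm mm ℂ)ᴴ)ᴴ))))
    (NVc := fun _ => (0 : (CvX' d L mv kk r hL × ι → ℝ) →ₗ[ℝ] (CvX' d L mv kk r hL × ι → ℝ))) (Fl := fun k => (-tensorId ι (mulOp (bcube (2 * L) (coverXi (cvM d L mv kk hL) (L ^ r * L ^ kk) (L ^ mv)) 2 k) ∘ₗ (mulOp (chiCube (cvM d L mv kk hL) (L ^ r * L ^ kk) (coverCorner (cvM d L mv kk hL) (L ^ mv) L (coverMargin L mv) k) (L * L ^ mv)) ∘ₗ symOp (cvM d L mv kk hL) (L ^ r * L ^ kk) (coverCorner (cvM d L mv kk hL) (L ^ mv) L (coverMargin L mv) k) ∘ₗ (gOp (cvM d L mv kk hL) (L ^ r * L ^ kk) a ∘ₗ (mulOp (1 - (chiCube (cvM d L mv kk hL) (L ^ r * L ^ kk) (coverCorner (cvM d L mv kk hL) (L ^ mv) L (coverMargin L mv) k) (L * L ^ mv))) ∘ₗ (a • (qvAdjRe (cvM d L mv kk hL) (L ^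 r * L ^ kk) ∘ₗ qvRe (cvM d L mv kk hL) (L ^ r * L ^ kk)) + (-landauRe (cvM d L mv kk hL) (L ^ r * L ^ kk))) ∘ₗ mulOp (hcube (2 * L) (coverXi (cvM d L mv kk hL) (L ^ r * L ^ kk) (L ^ mv)) k))) ∘ₗ mulOp (chiCube (cvM d L mv kk hL) (L ^ r * L ^ kk) (coverCorner (cvM d L mv kk hL) (L ^ mv) L (coverMargin L mv) k) (L * L ^ mv)))))) (Δ := (covLapM (bshiftEquiv (cvM d L mv kk hL) (L ^ r * L ^ kk)) ((((L ^ r * L ^ kk : ℕ) : ℝ))⁻¹) (gaugePair (bshiftEquiv (cvM d L mv kk hL) (L ^ r * L ^ kk)) (fun μ x => coordMat e (ContinuousLinearMap.mulLeftRight ℝ (Matrix mm mm ℂ) (U' μ x) (U' μ x)ᴴ))) + cvNL' d L mv kk r hL a ι)) (NL := cvNL' d L mv kk r hL a ι) (Yop := (cvGlued' d L mv kk r hL a ((((L ^ r * L ^ kk : ℕ) : ℝ))⁻¹) ι e (fun _ _ => (1 : Matrix mm mm ℂ)) U' (cvNL' d L mv kk r hL a ι) (fun _ => 0)))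
    (χX := fun k => cvChi' d L mv kk r hL k) (χtX := fun k => cvBump' d L mv kk r hL k) (ψX := fun k => cvPsi' d L mv kk r hL k) (ψ₂X := fun k => cvPsi' d L mv kk r hL k) (hX := fun k => (knitH d L mv kk (L ^ r * L ^ kk) hL k)) (Sk := fun k => cvSk d L mv kk hL k) (hb := fun k => coverHb (cvM d L mv kk hL) (L ^ kk) (L ^ mv) L k) (Tf := fun k μ => tensorId ι (mulOp (chiCube (cvM d L mv kk hL) (L ^ r * L ^ kk) (coverCorner (cvM d L mv kk hL) (L ^ mv) L (coverMargin L mv) k) (L * L ^ mv)) ∘ₗ symOp (cvM d L mv kk hL) (L ^ r * L ^ kk) (coverCorner (cvM d L mv kk hL) (L ^ mv) L (coverMargin L mv) k) ∘ₗ (gOp (cvM d L mv kk hL) (L ^ r * L ^ kk) a ∘ₗ symbOp (cvM d L mv kk hL) (L ^ r * L ^ kk) (sD (cvM d L mv kk hL) (L ^ r * L ^ kk) μ (((L ^ r * L ^ kk) : ℕ) : ℝ))) ∘ₗ mulOp (chiCube (cvM d L mv kk hL) (L ^ r * L ^ kk) (coverCorner (cvM d L mv kk hL) (L ^ mv) L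 (coverMargin L mv) k) (L * L ^ mv)))) (Tb := fun k μ => tensorId ι (-(mulOp (chiCube (cvM d L mv kk hL) (L ^ r * L ^ kk) (coverCorner (cvM d L mv kk hL) (L ^ mv) L (coverMargin L mv) k) (L * L ^ mv)) ∘ₗ symOp (cvM d L mv kk hL) (L ^ r * L ^ kk) (coverCorner (cvM d L mv kk hL) (L ^ mv) L (coverMargin L mv) k) ∘ₗ (gOp (cvM d L mv kk hL) (L ^ r * L ^ kk) a ∘ₗ symbOp (cvM d L mv kk hL) (L ^ r * L ^ kk) ((((L ^ r * L ^ kk) : ℕ) : ℝ) • (sTinv (cvM d L mv kk hL) (L ^ r * L ^ kk) μ - 1))) ∘ₗ mulOp (chiCube (cvM d L mv kk hL) (L ^ r * L ^ kk) (coverCorner (cvM d L mv kk hL) (L ^ mv) L (coverMargin L mv) k) (L * L ^ mv)))))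
    (ρ₁ := δm / 2) (ρ₂ := δm / 4) (ρ₃ := δm / 8) (ρN := δm - δm / 2) (δV := δm) (δN := δm) (ε := δm / 2) (R := Rsp) (c₀ := π * W⁻¹) (c₁ := π * W⁻¹) (c₂ := 32 * π ^ 2 * W⁻¹) (cN := cNn * W⁻¹) (rA := R₀) (RN := 0) (ℓ := πD * W⁻¹) (ω := πD * W⁻¹) (β := β) (β₁ := β₁) (ct := π) (δ := δm) (βQ := βQ) (θA := θA) (θF := 0) (εE := ((1 - θA * cr)⁻¹ * (κF * W⁻¹) * cr)) (rC := R₀) (r₁ := R₀) (εF := κF * W⁻¹) (Nov := Nov) htri hd hsymm hd0 hrow (div_nonneg hδm0.le (by norm_num)) hβ0 hβ₁0 hβQ0 pi_pos.le hRsp0 hcr0 (mul_nonneg pi_pos.le hWinv0) (mul_nonneg pi_pos.le hWinv0) (mul_nonneg (by positivity) hWinv0) (mul_nonneg hcNn0 hWinv0) hR₀0.le le_rfl (mul_nonneg hπD0 hWinv0) (mul_nonneg hπD0 hWinv0) hθA0 le_rfl (mul_nonneg (mul_nonneg hIA0 (mul_nonneg hκF0 hWinv0)) hcr0) hNov0 hR₀0.le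 hR₀0.le (mul_nonneg hκF0 hWinv0) (half_pos hδm0) (by linarith only [hδm0]) (by linarith only [hδm0]) (by linarith only [hδm0]) (div_nonneg hδm0.le (by norm_num)) (by linarith only [hδm0]) (div_nonneg hδm0.le (by norm_num)) (by linarith only [hδm0]) (by linarith only [hδm0]) (by linarith only [hδm0]) (by linarith only [hδm0]) (by linarith only [hδm0]) (by linarith only [hδm0]) (fun k x hx => Finset.mem_coe.mpr (blockOf_kingPrV_mem_cubeBlocks_of_inner_ne_zero hM hm₁ hfitI hS0 hx)) (fun k x hx => Finset.mem_coe.mpr (blockOf_kingPrV_mem_cubeBlocks_of_chiCube_ne_zero hx)) (fun k x hx => Finset.mem_coe.mpr (blockOf_kingPrV_mem_cubeBlocks_of_chiCube_ne_zero hx)) (fun k x => abs_bcube_cover_le_one 2 k x)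
    (fun k x => abs_chiCube_le_one _ x) (fun k μ p => by rw [hη'inv]; exact (abs_fgrad_bcube_cover_lift_le 2 ι hM hw k μ p).trans (div_le_self pi_pos.le hW1)) (fun k μ p => by rw [hη'inv]; exact (abs_bgrad_bcube_cover_lift_le 2 ι hM hw k μ p).trans (div_le_self pi_pos.le hW1)) (fun k => bcube_cover_lift_cut 2 ι hM hw hlo hhi hS6 k) (fun k => cut_bcube_cover_lift 2 ι hM hw hlo hhi hS6 k) (fun k μ => bcube_cover_lift_comp_shift_cut 2 ι hM hw hlo hhi hS6 k μ) (fun k μ => bcube_cover_lift_comp_shift_symm_cut 2 ι hM hw hlo hhi hS6 k μ) (fun k μ => fgrad_bcube_cover_lift_cut 2 ι hM hw hlo hhi hS6 η'⁻¹ k μ) (fun k μ => bgrad_bcube_cover_lift_cut 2 ι hM hw hlo hhi hS6 η'⁻¹ k μ) (fun k => cutCube_comp_psi_cover_lift ι hM ha k) (fun k => by rw [cut_comp_cutCube_cover_lift ι hM hm₁ hfitI hS0 k]; exact hasMaj_src_tgt_congr (liftBlk_blkCover_comp_kingPrV ι).symm (hasMaj_cut_cover_lift (m₀ := coverMargin L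 mv) ι hM hm₁ hfitI hS0 hC.le hδ₀.le hδmδ₀ hG' k)) (fun k μ => by rw [cut_fgrad_cutCube_cover_lift ι hM hm₂ hfit₂ hS0 η'⁻¹ μ k]; exact hasMaj_src_tgt_congr (liftBlk_blkCover_comp_kingPrV ι).symm (hasMaj_cutF_cover_lift (m₀ := coverMargin L mv) ι hM hm₁ hfitI hS0 hC hδ₀ hδmδ₀ hη'inv μ (hD' μ) k)) (fun k μ => by rw [cut_bgrad_cutCube_cover_lift ι hM hm₂ hfit₂ hS0 η'⁻¹ μ k]; exact hasMaj_src_tgt_congr (liftBlk_blkCover_comp_kingPrV ι).symm (hasMaj_cutB_cover_lift (m₀ := coverMargin L mv) ι hM hm₁ hfitI hS0 hC hδ₀ hδmδ₀ hη'inv μ (hD' μ) k))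
    (fun k μ => cutCube_fgrad_cover_lift_sandwich ι hM hm₂ hfit₂ hS0 ha hη'inv μ k) (fun k μ => cutCube_bgrad_cover_lift_sandwich ι hM hm₂ hfit₂ hS0 ha hη'inv μ k) (fun k μ => hasMaj_src_tgt_congr (liftBlk_blkCover_comp_kingPrV ι).symm ((hasMaj_tensorId ι (fun y y' => mul_nonneg (mul_nonneg (ind_nonneg _ _) (ind_nonneg _ _)) (mul_nonneg (mul_nonneg (pow_nonneg zero_le_two _) (mul_nonneg (mul_nonneg zero_le_two (mul_nonneg hC.le (Real.exp_nonneg _))) (Real.exp_nonneg _))) (Real.exp_nonneg _))) (hasMaj_chiCube_symOp_gGrad_of (L := L) (k := kk) (c := (coverCorner (cvM d L mv kk hL) (L ^ mv) L (coverMargin L mv) k)) (S := L * L ^ mv) hM' (mul_nonneg zero_le_two (mul_nonneg hC.le (Real.exp_nonneg _))) hδ₀.le μ (hGg' μ))).mono fun y y' => mul_le_mul_of_nonneg_left ((exp_rate_mono hd (mul_nonneg (pow_nonneg zero_le_two _) (mul_nonneg (mul_nonneg zero_le_two (mul_nonneg hC.le (Real.exp_nonneg _))) (Real.exp_nonneg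 _))) hδmδ₀ y y').trans (le_of_eq (by rw [hβQdef]))) (mul_nonneg (ind_nonneg _ _) (ind_nonneg _ _))))
    (fun k μ => hasMaj_src_tgt_congr (liftBlk_blkCover_comp_kingPrV ι).symm (((hasMaj_tensorId ι (fun y y' => mul_nonneg (mul_nonneg (ind_nonneg _ _) (ind_nonneg _ _)) (mul_nonneg (mul_nonneg (pow_nonneg zero_le_two _) (mul_nonneg hC.le (Real.exp_nonneg _))) (Real.exp_nonneg _))) (hasMaj_chiCube_symOp_gDivAdj_of_ineq (L := L) (k := kk) hn' hM' Hk' hC.le hδ₀.le (coverCorner (cvM d L mv kk hL) (L ^ mv) L (coverMargin L mv) k) μ)).mono fun y y' => mul_le_mul_of_nonneg_left ((exp_rate_mono hd (mul_nonneg (pow_nonneg zero_le_two _) (mul_nonneg hC.le (Real.exp_nonneg _))) hδmδ₀ y y').trans (mul_le_mul_of_nonneg_right hββQ (Real.exp_nonneg _))) (mul_nonneg (ind_nonneg _ _) (ind_nonneg _ _))).neg)) (fun k μ => rightEntryF_comp_psi_cover_lift ι μ k) (fun k μ => rightEntryB_comp_psi_cover_lift ι μ k) hV' hq hqA (le_of_eq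 (by rw [hθAdef, hθ₁def, hcJdef]; ring)) le_rfl (fun k x => abs_coverH_le_one k x) (fun k => hcube_cut (2 * L) (fun ν (p : CvX' d L mv kk r hL × ι) => coverXi (cvM d L mv kk hL) (L ^ r * L ^ kk) (L ^ mv) ν p.1) (fun μ => liftEquiv ((bshiftEquiv (cvM d L mv kk hL) (L ^ r * L ^ kk)) μ) ι) 0 (hwin' 0 k)) (fun k μ x => by rw [hη'inv]; exact (abs_fgrad_coverH_le hM hw k μ x).trans_eq (div_eq_mul_inv _ _)) (fun k μ x => by rw [hη'inv]; exact (abs_bgrad_coverH_le hM hw k μ x).trans_eq (div_eq_mul_inv _ _))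
    (fun k μ x => abs_shift_sub_le_of_fgrad η'⁻¹ ((bshiftEquiv (cvM d L mv kk hL) (L ^ r * L ^ kk)) μ) hη'1 (fun x => by rw [hη'inv]; exact (abs_fgrad_coverH_le hM hw k μ x).trans_eq (div_eq_mul_inv _ _)) x) (fun k y y' => (abs_coverHb_sub_le hM hw k y y').trans_eq (by rw [hπDdef, div_eq_mul_inv])) (fun k x' => by have h := abs_coverH_sub_coverHb_le (M := (cvM d L mv kk hL)) (n := L ^ r * L ^ kk) hM hw k x'; rw [coverHb_eq_of_spacing (L ^ kk) (L ^ r * L ^ kk) hw k, ← congrFun (VectorPiece.blkFine_comp_kingPrV (M := (cvM d L mv kk hL)) L kk r) x'] at h; exact h.trans_eq (by rw [hπDdef, div_eq_mul_inv])) hh2' (fun k μ p => abs_fgrad_fgrad_le_of _ _ (hh2' k μ) p) (fun k μ p => abs_bgrad_bgrad_shift_le_of _ _ (hh2' k μ) p) (fun k μ x h => coverH_layer_bwd hM hw hS6 k μ x h) (fun k μ x h => coverH_layer_fwd hM hw hS6 k μ x h) (fun k x h => coverH_layer_shift hM hw hS6 k ν x h) (fun p => sum_coverH_sq p.1) (fun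 k j x i => (hAg' j x i).trans hrSle) (fun k x i => (hCg' x i).trans hrSle) (fun k μ x i => (hga' μ x i).trans hrSle) (fun k μ x i => (hgb' μ x i).trans hrSle) (fun k => (hasMaj_src_tgt_congr (liftBlk_blkCover_comp_kingPrV ι).symm (hasMaj_commOp_nonlocal_cover_lift (δN := δm) ι hM hw hC₁.le hδm0.le hδmδ₁ (half_pos hδm0) hNL' k)).mono fun y y' => le_of_eq (by simp only [hcNndef, hπDdef, hE'def, hWdef, hcN₀def]; ring)) (fun k => (hasMaj_zero _ _).mono fun y y' => le_of_eq (zero_mul _).symm)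
    (fun y => sum_ind_cubeBlocks_le (M := (cvM d L mv kk hL)) (w := L ^ mv) (q := L) (m₀ := coverMargin L mv) L kk y) hcov₀' (fun k => by rw [bump_comp_cutCube_cover_lift ι hM hw hm₁ hhi4 k]; exact adjTail_cover_lift_eq ι hM hw hm₁ hhi4 ha hη'inv k) (fun k => by rw [LinearMap.comp_neg, mulOp_fst_comp_tensorId, ← LinearMap.comp_assoc, cut_bcube_cover 2 hM hw hlo hhi hS6 k]) (fun k => by rw [LinearMap.neg_comp, tensorId_comp_mulOp_fst_of ι (by rw [LinearMap.comp_assoc, LinearMap.comp_assoc, LinearMap.comp_assoc, LinearMap.comp_assoc, mulOp_chiCube_idem])]) (fun k => (hasMaj_src_tgt_congr (liftBlk_blkCover_comp_kingPrV ι).symm ((hasMaj_adjTail_cover_lift (L := L) (kk := kk) ι hM hw hfit0 (δN := δm) (ρ₁ := 3 * δm / 4) (ρ := δm / 2) htri hrow hC.le hC₁.le hδm0.le hδmδ₁ (by linarith only [hδm0]) (div_nonneg hδm0.le zero_le_two) (by linarith only [hδm0]) (by linarith only [hδmδ₀, hδm0]) hG' hNL' k).mono fun y y' => (loc₂_le_plain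 hF0 y y').trans (mul_le_mul_of_nonneg_right hεF (Real.exp_nonneg _)))).neg) hqL hY'
  refine key.mono fun y y' => le_of_le_of_eq (mul_le_mul_of_nonneg_right ?_ (Real.exp_nonneg _)) (by rw [show δm / 8 - 2 * (δm / 32) = δm / 16 by ring])
  -- the constant: `(1 − q)⁻¹ ≤ 2`, `c₁ ≤ π`
  have hq2 : (1 - Nov * ((((((cJ * ((3 * (((β + (β₁ + (π * β))) * (1 - (((β + (β₁ + (π * β))) * (Rsp * cr)) * cr))⁻¹) * (32 * π ^ 2 * W⁻¹))) + (2 * ((((1 - (θA * cr))⁻¹ * βQ) * cr) * (π * W⁻¹))))) + 0) + ((((β + (β₁ + (π * β))) * (1 - (((β + (β₁ + (π * β))) * (Rsp * cr)) * cr))⁻¹) * (cNn * W⁻¹)) * cr)) + ((cJ * ((2 * R₀) * (((π * W⁻¹) * ((β + (β₁ + (π * β))) * (1 - (((β + (β₁ + (π * β))) * (Rsp * cr)) * cr))⁻¹)) + ((π * W⁻¹) * (((1 - (θA * cr))⁻¹ * βQ) * cr))))) + ((((β + (β₁ + (π * β))) * (1 - (((β + (β₁ + (π * β))) * (Rsp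 * cr)) * cr))⁻¹) * ((((πD * W⁻¹) * ((Real.exp 1) * (δm / 2))⁻¹) + (2 * (πD * W⁻¹))) * 0)) * cr))) + 0) + (((1 - (θA * cr))⁻¹ * (κF * W⁻¹)) * cr)) * cr)⁻¹ ≤ 2 := by
    have hle : Nov * ((((((cJ * ((3 * (((β + (β₁ + (π * β))) * (1 - (((β + (β₁ + (π * β))) * (Rsp * cr)) * cr))⁻¹) * (32 * π ^ 2 * W⁻¹))) + (2 * ((((1 - (θA * cr))⁻¹ * βQ) * cr) * (π * W⁻¹))))) + 0) + ((((β + (β₁ + (π * β))) * (1 - (((β + (β₁ + (π * β))) * (Rsp * cr)) * cr))⁻¹) * (cNn * W⁻¹)) * cr)) + ((cJ * ((2 * R₀) * (((π * W⁻¹) * ((β + (β₁ + (π * β))) * (1 - (((β + (β₁ + (π * β))) * (Rsp * cr)) * cr))⁻¹)) + ((π * W⁻¹) * (((1 - (θA * cr))⁻¹ * βQ) * cr))))) + ((((β + (β₁ + (π * β))) * (1 - (((β + (β₁ + (π * β))) * (Rsp * cr)) * cr))⁻¹) * ((((πD * W⁻¹) * ((Real.exp 1) * (δm / 2))⁻¹)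 + (2 * (πD * W⁻¹))) * 0)) * cr))) + 0) + (((1 - (θA * cr))⁻¹ * (κF * W⁻¹)) * cr)) * cr ≤ 1 / 2 := by
      rw [hΘ, show Nov * (Ktot * W⁻¹) * cr = (Nov * Ktot * cr) * W⁻¹ by ring]
      have h1 : (Nov * Ktot * cr) * W⁻¹ ≤ (W / 2) * W⁻¹ := mul_le_mul_of_nonneg_right (by linarith only [hWK]) hWinv0
      rwa [show (W / 2) * W⁻¹ = 1 / 2 by rw [div_eq_mul_inv, mul_right_comm, mul_inv_cancel₀ hWpos.ne', one_mul, one_div]] at h1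
    rw [inv_le_comm₀ (by linarith only [hle]) (by norm_num)]; linarith only [hle]
  have hX0 : 0 ≤ Nov * (((1 - θA * cr)⁻¹ * βQ * cr) * 1 + ((β + (β₁ + π * β)) * (1 - (β + (β₁ + π * β)) * (Rsp * cr) * cr)⁻¹) * (π * W⁻¹)) * cr := mul_nonneg (mul_nonneg hNov0 (add_nonneg (mul_nonneg hBX0 zero_le_one) (mul_nonneg hBB0 (mul_nonneg pi_pos.le hWinv0)))) hcr0
  calc (1 - Nov * ((((((cJ * ((3 * (((β + (β₁ + (π * β))) * (1 - (((β + (β₁ + (π * β))) * (Rsp * cr)) * cr))⁻¹) * (32 * π ^ 2 * W⁻¹))) + (2 * ((((1 - (θA * cr))⁻¹ * βQ) * cr) * (π * W⁻¹))))) + 0) + ((((β + (β₁ + (π * β))) * (1 - (((β + (β₁ + (π * β))) * (Rsp * cr)) * cr))⁻¹) * (cNn * W⁻¹)) * cr)) + ((cJ * ((2 * R₀) * (((π * W⁻¹) * ((β + (β₁ + (π * β))) * (1 - (((β + (β₁ + (π * β))) * (Rsp * cr)) * cr))⁻¹)) + ((π * W⁻¹) * (((1 - (θA * cr))⁻¹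 * βQ) * cr))))) + ((((β + (β₁ + (π * β))) * (1 - (((β + (β₁ + (π * β))) * (Rsp * cr)) * cr))⁻¹) * ((((πD * W⁻¹) * ((Real.exp 1) * (δm / 2))⁻¹) + (2 * (πD * W⁻¹))) * 0)) * cr))) + 0) + (((1 - (θA * cr))⁻¹ * (κF * W⁻¹)) * cr)) * cr)⁻¹ * (Nov * (((1 - θA * cr)⁻¹ * βQ * cr) * 1 + ((β + (β₁ + π * β)) * (1 - (β + (β₁ + π * β)) * (Rsp * cr) * cr)⁻¹) * (π * W⁻¹))) * cr
      ≤ 2 * ((Nov * (((1 - θA * cr)⁻¹ * βQ * cr) * 1 + ((β + (β₁ + π * β)) * (1 - (β + (β₁ + π * β)) * (Rsp * cr) * cr)⁻¹) * π)) * cr) := by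
        rw [mul_assoc]
        refine mul_le_mul hq2 ?_ hX0 (by norm_num)
        have : ((β + (β₁ + π * β)) * (1 - (β + (β₁ + π * β)) * (Rsp * cr) * cr)⁻¹) * (π * W⁻¹) ≤ ((β + (β₁ + π * β)) * (1 - (β + (β₁ + π * β)) * (Rsp * cr) * cr)⁻¹) * π := by
          have := mul_le_mul_of_nonneg_left hWinv1 (mul_nonneg hBB0 pi_pos.le)
          calc ((β + (β₁ + π * β)) * (1 - (β + (β₁ + π * β)) * (Rsp * cr) * cr)⁻¹) * (π * W⁻¹) = ((β + (β₁ + π * β)) * (1 - (β + (β₁ + π * β)) * (Rsp * cr) * cr)⁻¹) * π * W⁻¹ := by ring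
            _ ≤ ((β + (β₁ + π * β)) * (1 - (β + (β₁ + π * β)) * (Rsp * cr) * cr)⁻¹) * π * 1 := this
            _ = ((β + (β₁ + π * β)) * (1 - (β + (β₁ + π * β)) * (Rsp * cr) * cr)⁻¹) * π := mul_one _
        exact mul_le_mul_of_nonneg_right (mul_le_mul_of_nonneg_left (add_le_add le_rfl this) hNov0) hcr0
    _ ≤ Bout := by rw [hBoutdef]; linarith

end Knit

end Summit.QuantumFields.YangMills.BalabanUVNodes.N15.Gluing

end
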